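import Literature.Topology.FourManifolds.TautFoliationsHolonomy
import Literature.Topology.FourManifolds.TautFoliationsLeafPaths
import Mathlib.Topology.UrysohnsLemma
import HarnessLib

/-!
# Fences: product neighbourhoods of a `C⁰` codimension-one foliation over leaf maps with trivial holonomy

Sibling of `TautFoliationsHolonomy.lean` (the germ covering `GermSpace.proj : F.GermSpace →
F.LeafSpace` and the continuation of distinguished maps along leaf paths; over a simply
connected domain a leaf map `g : A → M^δ` lifts to a continuous family `G : A → F.GermSpace`
of germs of local first integrals). This file realises such a family **geometrically**: it
constructs a *fence* over `g` — a continuous map `Φ : A × (τ₀ - ε, τ₀ + ε) → M` with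
`Φ(a, τ₀) = g a`, whose verticals `τ ↦ Φ(a, τ)` are transversals and whose horizontals
`a ↦ Φ(a, τ)` are leaf maps, `Φ(a, τ)` lying on the local leaf on which the first integral
`G a` takes the value `τ` (Camacho–Lins Neto, *Geometric Theory of Foliations*, Ch. IV §2,
proof of the local stability theorem: "the union of the fibres of the normal tubular
neighbourhood over a simply connected subset of a leaf is foliated as a product"; Hector–
Hirsch, *Introduction to the Geometry of Foliations, Part A*, Ch. III 2.1.1–2.1.3, the
unwrapping `α : E → M` of a leaf and Cor. 2.1.3; here in the `C⁰` codimension-one setting,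
where the transverse fibres are the verticals of the flow boxes and overlapping boxes are
reconciled by convex interpolation in the leaf model `B`, a real normed space).

* `Foliation.LocalDatum F G τ₀ ε U` (**definition**): a local representation of the family
  of germs `G` on `U ⊆ A` — a flow box `e` of the atlas and a pair `(φ, ψ)` of mutually
  inverse homeomorphism germs with `G a = germ (φ ∘ h_e)` at its base point, the base points
  on the plaque of `e` at height `ψ τ₀`, `φ (ψ τ) = τ` on the level interval. Every point
  has one (`exists_localDatum`, from `exists_nhds_forall_eq_germSection`).
* `Foliation.IsFenceOn F G τ₀ ε Φ S` (**definition**): `Φ : A → ℝ → M` is a fence of level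
  radius `ε` over `S ⊆ A`: jointly continuous on `S × (τ₀ - ε, τ₀ + ε)`, `Φ a τ₀` the base
  point of `G a`, and near each point of `S` there is a local datum `(e, φ, ψ)` in whose box
  `Φ a' τ` has height `ψ τ` — so that the first integral `φ ∘ h_e` of `G a'` takes the value
  `τ` at `Φ a' τ`.
* **Consistency** (`IsFenceOn.eventually_level`, `IsFenceOn.exists_forall_level`): a fence
  levels correctly in *every* local datum, near each point and uniformly on compact sets —
  two local data define the same germs, hence the same local first integrals near the base
  points.
* **Gluing** (`IsFenceOn.glue`): a fence over an open set `S ⊇ K` and a local datum on an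
  open `U ⊇ K'` (`K, K'` compact) are merged into a fence over an open set containing
  `K ∪ K'`, interpolating the `B`-coordinates in the box of the datum with an Urysohn
  function (the step of the classical partition-of-unity construction of tubular
  neighbourhoods).
* **Existence of fences** (`exists_isFenceOn_univ`): over a compact Hausdorff `A`, every
  continuous family `G : A → F.GermSpace` of constant level `τ₀` (e.g. the lift of a leaf
  map from a simply connected `A`, `existsUnique_lift_of_simplyConnectedSpace`) admits a
  fence over all of `A`; its horizontals are leaf maps (`IsFenceOn.continuous_toLeafSpace`)
  and its verticals are injective (`IsFenceOn.injOn`).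

## References

* C. Camacho, A. Lins Neto, *Geometric Theory of Foliations*, Birkhäuser (1985), Ch. IV §2
  (local stability), Ch. III §2 (distinguished maps) [CamachoLinsNeto1985].
* G. Hector, U. Hirsch, *Introduction to the Geometry of Foliations, Part A*, 2nd ed., Vieweg
  (1986), Ch. III 2.1.1–2.1.3, 2.1.8 [HectorHirsch1986].

## Design notes

* The leaf model `B` is a real normed space (convex interpolation of `B`-coordinates inside
  one flow box); `M` is any topological space; `A` is compact Hausdorff where fences are
  glued (Urysohn functions, tube lemma).
* A fence is an honest function `Φ : A → ℝ → M`, meaningful on `S × (τ₀ - ε, τ₀ + ε)`; the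
  level interval shrinks at each gluing step, which is why the radius `ε` is a parameter of
  `IsFenceOn` and `LocalDatum`.
-/
open scoped Topology
open Function Set Filter Topology

namespace Literature.Topology.FourManifolds

namespace Foliation

variable {B : Type*} [NormedAddCommGroup B] {M : Type*} [TopologicalSpace M]
variable (F : Foliation B M)

-- BODY
/-! ## The interpolation formula -/

section GlueFun

variable {F} [NormedSpace ℝ B] {A : Type*}

/-- **The glued fence.** On `W'` the `B`-coordinate in the box `e` of the datum is the convex
combination, with weight `ρ a`, of that of the old fence and that of the base point, at height
`ψ τ`; elsewhere the old fence. [folklore] -/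
noncomputable def glueFun (Φ : A → ℝ → M) (G : A → F.GermSpace) (e : OpenPartialHomeomorph M (B × ℝ))
    (ψ : ℝ → ℝ) (ρ : A → ℝ) (W' : Set A) : A → ℝ → M := by
  classical
  exact fun a τ ↦ if a ∈ W' then
    e.symm ((1 - ρ a) • (e (Φ a τ)).1 + ρ a • (e (ofLeafSpace (G a).pt)).1, ψ τ) else Φ a τ

/-- The glued fence on `W'`. [folklore] -/
theorem glueFun_of_mem {Φ : A → ℝ → M} {G : A → F.GermSpace} {e : OpenPartialHomeomorph M (B × ℝ)}
    {ψ : ℝ → ℝ} {ρ : A → ℝ} {W' : Set A} {a : A} (ha : a ∈ W') (τ : ℝ) :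
    glueFun Φ G e ψ ρ W' a τ =
      e.symm ((1 - ρ a) • (e (Φ a τ)).1 + ρ a • (e (ofLeafSpace (G a).pt)).1, ψ τ) := by
  classical
  simp only [glueFun, if_pos ha]

/-- The glued fence off `W'`. [folklore] -/
theorem glueFun_of_not_mem {Φ : A → ℝ → M} {G : A → F.GermSpace} {e : OpenPartialHomeomorph M (B × ℝ)}
    {ψ : ℝ → ℝ} {ρ : A → ℝ} {W' : Set A} {a : A} (ha : a ∉ W') (τ : ℝ) :
    glueFun Φ G e ψ ρ W' a τ = Φ a τ := by
  classical
  simp only [glueFun, if_neg ha]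

end GlueFun

/-! ## Local data: local representations of a continuous family of germs -/

section LocalData

variable {A : Type*}

/-- A **local datum** for the family of germs `G : A → F.GermSpace` on the set `U ⊆ A`, at
level `τ₀` with level radius `ε`: a flow box `box` of the atlas and functions `φ, ψ : ℝ → ℝ`
such that on `U` the germ `G a` is that of the local first integral `φ ∘ h_box` at its base
point, which lies on the plaque of `box` at height `ψ τ₀`; `φ ∘ ψ = id` on the level interval
`(τ₀ - ε, τ₀ + ε)`, on which `ψ` is continuous and injective, and `ψ ∘ φ = id` near `ψ τ₀`.
So `ψ τ` is the `box`-height of the local leaf on which the first integrals take the value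
`τ`. [folklore] -/
structure LocalDatum (G : A → F.GermSpace) (τ₀ ε : ℝ) (U : Set A) where
  /-- The flow box. -/
  box : OpenPartialHomeomorph M (B × ℝ)
  /-- The flow box belongs to the atlas. -/
  box_mem : box ∈ F.atlas
  /-- The local first integral is `φ ∘ h_box`. -/
  φ : ℝ → ℝ
  /-- The inverse germ of `φ`: heights as a function of levels. -/
  ψ : ℝ → ℝ
  /-- On `U`, the germ `G a` is that of `φ ∘ h_box`. -/
  germ_eq : ∀ a ∈ U, (G a).germ = ↑(φ ∘ height box)
  /-- On `U`, the base points lie on the plaque of height `ψ τ₀`. -/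
  pt_mem : ∀ a ∈ U, ofLeafSpace (G a).pt ∈ plaque box (ψ τ₀)
  /-- `φ ∘ ψ = id` on the level interval. -/
  φ_ψ : ∀ τ ∈ Ioo (τ₀ - ε) (τ₀ + ε), φ (ψ τ) = τ
  /-- `ψ ∘ φ = id` near the base height. -/
  ψ_φ : ∀ᶠ r in 𝓝 (ψ τ₀), ψ (φ r) = r
  /-- `ψ` is continuous on the level interval. -/
  ψ_cont : ContinuousOn ψ (Ioo (τ₀ - ε) (τ₀ + ε))
  /-- `ψ` is injective on the level interval. -/
  ψ_inj : InjOn ψ (Ioo (τ₀ - ε) (τ₀ + ε))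

namespace LocalDatum

variable {F} {G : A → F.GermSpace} {τ₀ ε ε' : ℝ} {U U' : Set A}

/-- Restrict a local datum to a smaller set and a smaller level radius. [folklore] -/
def restrict (D : LocalDatum F G τ₀ ε U) (hU : U' ⊆ U) (hε : ε' ≤ ε) : LocalDatum F G τ₀ ε' U' where
  box := D.box
  box_mem := D.box_mem
  φ := D.φ
  ψ := D.ψ
  germ_eq a ha := D.germ_eq a (hU ha)
  pt_mem a ha := D.pt_mem a (hU ha)
  φ_ψ τ hτ := D.φ_ψ τ (Ioo_subset_Ioo (by linarith) (by linarith) hτ)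
  ψ_φ := D.ψ_φ
  ψ_cont := D.ψ_cont.mono (Ioo_subset_Ioo (by linarith) (by linarith))
  ψ_inj := D.ψ_inj.mono (Ioo_subset_Ioo (by linarith) (by linarith))

/-- The box of a restricted datum. [folklore] -/
@[simp] theorem restrict_box (D : LocalDatum F G τ₀ ε U) (hU : U' ⊆ U) (hε : ε' ≤ ε) :
    (D.restrict hU hε).box = D.box := rfl

/-- The height function of a restricted datum. [folklore] -/
@[simp] theorem restrict_ψ (D : LocalDatum F G τ₀ ε U) (hU : U' ⊆ U) (hε : ε' ≤ ε) :
    (D.restrict hU hε).ψ = D.ψ := rfl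

/-- On `U` the base points lie in the source of the box. [folklore] -/
theorem pt_mem_source (D : LocalDatum F G τ₀ ε U) {a : A} (ha : a ∈ U) :
    ofLeafSpace (G a).pt ∈ D.box.source :=
  (D.pt_mem a ha).1

/-- On `U` the base points have height `ψ τ₀`. [folklore] -/
theorem height_pt (D : LocalDatum F G τ₀ ε U) {a : A} (ha : a ∈ U) :
    height D.box (ofLeafSpace (G a).pt) = D.ψ τ₀ :=
  (D.pt_mem a ha).2

/-- **Two local data have the same local first integrals near a common base point**: at
`a ∈ U ∩ U'`, `φ ∘ h_e = φ' ∘ h_{e'}` near the base point of `G a` (both are the germ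
`G a`). [folklore] -/
theorem eventuallyEq (D : LocalDatum F G τ₀ ε U) {U' : Set A} {ε' : ℝ} (D' : LocalDatum F G τ₀ ε' U')
    {a : A} (ha : a ∈ U) (ha' : a ∈ U') :
    D.φ ∘ height D.box =ᶠ[𝓝 (ofLeafSpace (G a).pt)] D'.φ ∘ height D'.box :=
  Germ.coe_eq.1 ((D.germ_eq a ha).symm.trans (D'.germ_eq a ha'))

end LocalDatum

end LocalData

variable {A : Type*} [TopologicalSpace A]

/-- **Every point has a local datum.** For a continuous family `G : A → F.GermSpace` of germs
of constant level `τ₀` and a point `a`, there are `ε > 0`, an open neighbourhood `U` of `a`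
and a local datum for `G` on `U` with level radius `ε` (a flow box through the base point of
`G a`, the homeomorphism germ read in the local product structure of the germ covering, and
its inverse germ). [folklore] -/
theorem exists_localDatum [Nonempty B] [LocallyConnectedSpace B] (G : C(A, F.GermSpace)) {τ₀ : ℝ}
    (hG : ∀ a, GermSpace.level (G a) = τ₀) (a : A) :
    ∃ ε > (0 : ℝ), ∃ U : Set A, IsOpen U ∧ a ∈ U ∧ Nonempty (LocalDatum F G τ₀ ε U) := by
  obtain ⟨e, he, hae⟩ := F.exists_mem_source (ofLeafSpace (G a).pt)
  obtain ⟨φ, hφ, U₀, hU₀, hU⟩ := F.exists_nhds_forall_eq_germSection G a he hae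
  set t : ℝ := (e (ofLeafSpace (G a).pt)).2 with ht
  -- the level of `G a` is `φ t`
  have hφt : φ t = τ₀ := by
    obtain ⟨h₀, hGa⟩ := hU a (mem_of_mem_nhds hU₀)
    have := hG a
    rw [hGa, GermSpace.level_germSection] at this
    exact this
  -- the inverse germ
  obtain ⟨ψ, hψ, hψt, hψφ, hφψ⟩ := hφ.exists_inverse
  rw [hφt] at hψ hψt hφψ
  obtain ⟨ε₁, hε₁, hc₁, hm₁⟩ := hψ
  obtain ⟨ε₂, hε₂, hsub₂⟩ := IsHomeoGermAt.exists_Ioo_subset_of_mem_nhds hφψ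
  obtain ⟨O, hOU, hOo, haO⟩ := mem_nhds_iff.1 hU₀
  refine ⟨min ε₁ ε₂, lt_min hε₁ hε₂, O, hOo, haO, ⟨?_⟩⟩
  have hI₁ : Ioo (τ₀ - min ε₁ ε₂) (τ₀ + min ε₁ ε₂) ⊆ Ioo (τ₀ - ε₁) (τ₀ + ε₁) :=
    Ioo_subset_Ioo (by linarith [min_le_left ε₁ ε₂]) (by linarith [min_le_left ε₁ ε₂])
  have hI₂ : Ioo (τ₀ - min ε₁ ε₂) (τ₀ + min ε₁ ε₂) ⊆ Ioo (τ₀ - ε₂) (τ₀ + ε₂) :=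
    Ioo_subset_Ioo (by linarith [min_le_right ε₁ ε₂]) (by linarith [min_le_right ε₁ ε₂])
  exact
    { box := e
      box_mem := he
      φ := φ
      ψ := ψ
      germ_eq := fun a' ha' ↦ by
        obtain ⟨-, hGa'⟩ := hU a' (hOU ha')
        rw [hGa', germSection_germ]
      pt_mem := fun a' ha' ↦ by
        obtain ⟨h₀, -⟩ := hU a' (hOU ha')
        rwa [hψt]
      φ_ψ := fun τ hτ ↦ hsub₂ (hI₂ hτ)
      ψ_φ := by rwa [hψt]
      ψ_cont := hc₁.mono hI₁
      ψ_inj := (hm₁.elim StrictMonoOn.injOn StrictAntiOn.injOn).mono hI₁ }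

/-! ## Fences -/

/-- **Fences.** `Φ : A → ℝ → M` is a *fence* for the family of germs `G` at level `τ₀` with
level radius `ε` over the set `S ⊆ A` if: `(a, τ) ↦ Φ a τ` is continuous on
`S × (τ₀ - ε, τ₀ + ε)`; `Φ a τ₀` is the base point of `G a` for `a ∈ S`; and every point of
`S` has a neighbourhood `U` with a local datum `(e, φ, ψ)` for `G` on `U ∩ S` in whose box the
points `Φ a' τ` (`a' ∈ U ∩ S`, `τ` in the level interval) have height `ψ τ` — so that the
local first integral `φ ∘ h_e` representing `G a'` takes the value `τ` at `Φ a' τ`: the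
horizontal `a' ↦ Φ a' τ` runs in the local leaves of level `τ`, the vertical `τ ↦ Φ a' τ` is
a transversal (Camacho–Lins Neto, Ch. IV §2; Hector–Hirsch A, Ch. III 2.1.1).
[cite: CamachoLinsNeto1985, Ch. IV §2] -/
structure IsFenceOn (G : A → F.GermSpace) (τ₀ ε : ℝ) (Φ : A → ℝ → M) (S : Set A) : Prop where
  /-- Joint continuity on `S × (τ₀ - ε, τ₀ + ε)`. -/
  cont : ContinuousOn (uncurry Φ) (S ×ˢ Ioo (τ₀ - ε) (τ₀ + ε))
  /-- At level `τ₀` the fence is the base point. -/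
  base : ∀ a ∈ S, Φ a τ₀ = ofLeafSpace (G a).pt
  /-- Near each point, the fence levels correctly in some local datum. -/
  local_level : ∀ a ∈ S, ∃ U ∈ 𝓝 a, ∃ D : LocalDatum F G τ₀ ε (U ∩ S),
    ∀ a' ∈ U ∩ S, ∀ τ ∈ Ioo (τ₀ - ε) (τ₀ + ε),
      Φ a' τ ∈ D.box.source ∧ height D.box (Φ a' τ) = D.ψ τ

namespace IsFenceOn

variable {F} {G : A → F.GermSpace} {τ₀ ε : ℝ} {Φ : A → ℝ → M} {S : Set A}

/-- The empty fence. [folklore] -/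
theorem empty (G : A → F.GermSpace) (τ₀ ε : ℝ) (Φ : A → ℝ → M) : IsFenceOn F G τ₀ ε Φ ∅ :=
  ⟨by rw [empty_prod]; exact continuousOn_empty _, fun _ h ↦ h.elim, fun _ h ↦ h.elim⟩

/-- Restricting a fence to a smaller set and a smaller level radius. [folklore] -/
theorem mono (h : IsFenceOn F G τ₀ ε Φ S) {S' : Set A} (hS : S' ⊆ S) {ε' : ℝ} (hε : ε' ≤ ε) :
    IsFenceOn F G τ₀ ε' Φ S' := by
  have hI : Ioo (τ₀ - ε') (τ₀ + ε') ⊆ Ioo (τ₀ - ε) (τ₀ + ε) := Ioo_subset_Ioo (by linarith) (by linarith)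
  refine ⟨h.cont.mono (prod_mono hS hI), fun a ha ↦ h.base a (hS ha), fun a ha ↦ ?_⟩
  obtain ⟨U, hU, D, hD⟩ := h.local_level a (hS ha)
  refine ⟨U, hU, D.restrict (inter_subset_inter_right _ hS) hε, fun a' ha' τ hτ ↦ ?_⟩
  exact hD a' ⟨ha'.1, hS ha'.2⟩ τ (hI hτ)

/-- A fence over an open set is continuous at the points of `S × (τ₀ - ε, τ₀ + ε)`. [folklore] -/
theorem continuousAt (h : IsFenceOn F G τ₀ ε Φ S) (hS : IsOpen S) {a : A} (ha : a ∈ S) {τ : ℝ}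
    (hτ : τ ∈ Ioo (τ₀ - ε) (τ₀ + ε)) : ContinuousAt (uncurry Φ) (a, τ) :=
  h.cont.continuousAt ((hS.prod isOpen_Ioo).mem_nhds ⟨ha, hτ⟩)

/-- **Consistency of fences with local data.** If `Φ` is a fence over the open set `S` and
`D` is *any* local datum for `G` on `U`, then near `(a, τ₀)` for `a ∈ S ∩ U` the fence also
levels correctly in `D`: `Φ a' τ` lies in the box of `D` at height `D.ψ τ` (for `a' ∈ U ∩ S`).
The local datum of the fence at `a` and `D` represent the same germ `G a`, hence the same
local first integral near the base point `Φ a τ₀`; there its value at `Φ a' τ` is `τ`.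
[folklore] -/
theorem eventually_level (h : IsFenceOn F G τ₀ ε Φ S) (hS : IsOpen S) (hε : 0 < ε) {U : Set A}
    {ε' : ℝ} (D : LocalDatum F G τ₀ ε' U) {a : A} (haS : a ∈ S) (haU : a ∈ U) :
    ∀ᶠ x : A × ℝ in 𝓝 (a, τ₀), x.1 ∈ U → x.1 ∈ S → x.2 ∈ Ioo (τ₀ - ε) (τ₀ + ε) →
      Φ x.1 x.2 ∈ D.box.source ∧ height D.box (Φ x.1 x.2) = D.ψ x.2 := by
  obtain ⟨U₁, hU₁, D₁, hD₁⟩ := h.local_level a haS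
  have ha₁ : a ∈ U₁ ∩ S := ⟨mem_of_mem_nhds hU₁, haS⟩
  -- the two local first integrals agree near the base point `g a = Φ a τ₀`
  have hgerm := D₁.eventuallyEq D ha₁ haU
  have hτ₀ : τ₀ ∈ Ioo (τ₀ - ε) (τ₀ + ε) := ⟨by linarith, by linarith⟩
  have hca : ContinuousAt (uncurry Φ) (a, τ₀) := h.continuousAt hS haS hτ₀
  have hval : uncurry Φ (a, τ₀) = ofLeafSpace (G a).pt := h.base a haS
  -- eventually: `a' ∈ U₁`, `Φ a' τ` in the agreement set and in the source of `D.box`,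
  -- and `h_D (Φ a' τ)` in the set where `ψ ∘ φ = id`
  have h₁ : ∀ᶠ x : A × ℝ in 𝓝 (a, τ₀), x.1 ∈ U₁ := (continuous_fst.tendsto _).eventually hU₁
  have h₂ : ∀ᶠ x : A × ℝ in 𝓝 (a, τ₀),
      (D₁.φ ∘ height D₁.box) (uncurry Φ x) = (D.φ ∘ height D.box) (uncurry Φ x) ∧
        uncurry Φ x ∈ D.box.source := by
    have hn : {w | (D₁.φ ∘ height D₁.box) w = (D.φ ∘ height D.box) w} ∩ D.box.source ∈
        𝓝 (uncurry Φ (a, τ₀)) := by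
      rw [hval]
      exact inter_mem hgerm (D.box.open_source.mem_nhds (D.pt_mem_source haU))
    exact hca.preimage_mem_nhds hn
  have h₃ : ∀ᶠ x : A × ℝ in 𝓝 (a, τ₀), D.ψ (D.φ (height D.box (uncurry Φ x))) =
      height D.box (uncurry Φ x) := by
    have hc : ContinuousAt (fun x ↦ height D.box (uncurry Φ x)) (a, τ₀) :=
      (continuousAt_height (by rw [hval]; exact D.pt_mem_source haU)).comp hca
    have hv : height D.box (uncurry Φ (a, τ₀)) = D.ψ τ₀ := by rw [hval]; exact D.height_pt haU
    have := D.ψ_φ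
    rw [← hv] at this
    exact hc.eventually this
  filter_upwards [h₁, h₂, h₃] with x hx₁ hx₂ hx₃ hxU hxS hxτ
  obtain ⟨-, hlev₁⟩ := hD₁ x.1 ⟨hx₁, hxS⟩ x.2 hxτ
  refine ⟨hx₂.2, ?_⟩
  -- `φ (h_D (Φ x)) = φ₁ (h₁ (Φ x)) = φ₁ (ψ₁ τ) = τ`, then apply `ψ`
  have key : D.φ (height D.box (Φ x.1 x.2)) = x.2 := by
    have e₁ : (D₁.φ ∘ height D₁.box) (uncurry Φ x) = (D.φ ∘ height D.box) (uncurry Φ x) := hx₂.1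
    simp only [comp_apply, uncurry] at e₁
    rw [← e₁, hlev₁]
    exact D₁.φ_ψ x.2 hxτ
  have hx₃' : D.ψ (D.φ (height D.box (Φ x.1 x.2))) = height D.box (Φ x.1 x.2) := hx₃
  rw [key] at hx₃'
  exact hx₃'.symm

/-- **Uniform consistency on compact sets**: a fence over an open `S` levels correctly in a
local datum `D` on `U`, uniformly on every compact `C ⊆ S ∩ U` for a smaller level radius
(tube lemma). [folklore] -/
theorem exists_forall_level (h : IsFenceOn F G τ₀ ε Φ S) (hS : IsOpen S) (hε : 0 < ε) {U : Set A}
    {ε' : ℝ} (D : LocalDatum F G τ₀ ε' U) {C : Set A} (hC : IsCompact C) (hCS : C ⊆ S)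
    (hCU : C ⊆ U) :
    ∃ δ > (0 : ℝ), δ ≤ ε ∧ ∀ a ∈ C, ∀ τ ∈ Ioo (τ₀ - δ) (τ₀ + δ),
      Φ a τ ∈ D.box.source ∧ height D.box (Φ a τ) = D.ψ τ := by
  -- the set of good pairs contains an open set around `C × {τ₀}`
  let W : Set (A × ℝ) := {x | x.1 ∈ U → x.1 ∈ S → x.2 ∈ Ioo (τ₀ - ε) (τ₀ + ε) →
    Φ x.1 x.2 ∈ D.box.source ∧ height D.box (Φ x.1 x.2) = D.ψ x.2}
  have hsub : C ×ˢ ({τ₀} : Set ℝ) ⊆ interior W := by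
    rintro ⟨a, τ⟩ ⟨haC, hτ⟩
    have hτ' : τ = τ₀ := hτ
    subst hτ'
    exact mem_interior_iff_mem_nhds.2 (h.eventually_level hS hε D (hCS haC) (hCU haC))
  obtain ⟨u, v, hu, hv, hCu, hτv, huv⟩ :=
    generalized_tube_lemma hC isCompact_singleton isOpen_interior hsub
  obtain ⟨δ, hδ, hδv⟩ := IsHomeoGermAt.exists_Ioo_subset_of_mem_nhds
    (hv.mem_nhds (hτv (mem_singleton τ₀)))
  refine ⟨min δ ε, lt_min hδ hε, min_le_right _ _, fun a ha τ hτ ↦ ?_⟩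
  have hτδ : τ ∈ Ioo (τ₀ - δ) (τ₀ + δ) :=
    Ioo_subset_Ioo (by linarith [min_le_left δ ε]) (by linarith [min_le_left δ ε]) hτ
  have hτε : τ ∈ Ioo (τ₀ - ε) (τ₀ + ε) :=
    Ioo_subset_Ioo (by linarith [min_le_right δ ε]) (by linarith [min_le_right δ ε]) hτ
  have hmem : (a, τ) ∈ W := interior_subset (huv ⟨hCu ha, hδv hτδ⟩)
  exact hmem (hCU ha) (hCS ha) hτε

end IsFenceOn

/-- The base point map `a ↦ g a` of a continuous family of germs is continuous. [folklore] -/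
theorem continuous_ofLeafSpace_pt (G : C(A, F.GermSpace)) :
    Continuous fun a ↦ ofLeafSpace (G a).pt :=
  F.continuous_ofLeafSpace.comp (GermSpace.continuous_proj.comp G.continuous)

/-! ## Gluing a fence with a local datum -/

section Glue

variable {F} [NormedSpace ℝ B] {G : A → F.GermSpace} {τ₀ ε : ℝ} {Φ : A → ℝ → M} {S U : Set A}

/-- **The gluing step.** Let `Φ` be a fence of level radius `ε` over the open set `S ⊇ K`,
`K` compact, and let `D` be a local datum on the open set `U ⊇ K'`, `K'` compact, in a compact
Hausdorff parameter space. Then there is a fence of some level radius `δ ≤ ε` over an open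
set containing `K ∪ K'`, equal to `Φ` near `K`. Construction: open `V ⊇ K`, `W ⊇ V̄` with `W̄ ⊆ S`, open `W' ⊇ K'`
with `W̄' ⊆ U`; an Urysohn function `ρ` vanishing on `V̄` and equal to `1` off `W`; `δ`
from the uniform consistency of `Φ` with `D` on the compact `W̄ ∩ W̄'`; the new fence is
`glueFun` over `V ∪ W'` (Camacho–Lins Neto, Ch. IV §2, proof of Thm. 2; Hector–Hirsch A,
Ch. III 2.1.1, the local unwrapping). [cite: CamachoLinsNeto1985, Ch. IV §2] -/
theorem IsFenceOn.glue [CompactSpace A] [T2Space A] (G : C(A, F.GermSpace)) (hΦ : IsFenceOn F G τ₀ ε Φ S)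
    (hS : IsOpen S) (hε : 0 < ε) {K : Set A} (hK : IsCompact K) (hKS : K ⊆ S)
    (D : LocalDatum F G τ₀ ε U) (hU : IsOpen U) {K' : Set A} (hK' : IsCompact K') (hK'U : K' ⊆ U) :
    ∃ S' : Set A, IsOpen S' ∧ K ∪ K' ⊆ S' ∧ ∃ δ > (0 : ℝ), δ ≤ ε ∧ ∃ Φ' : A → ℝ → M,
      IsFenceOn F G τ₀ δ Φ' S' ∧ ∃ V : Set A, IsOpen V ∧ K ⊆ V ∧
        ∀ a ∈ V, ∀ τ ∈ Ioo (τ₀ - δ) (τ₀ + δ), Φ' a τ = Φ a τ := by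
  classical
  -- shrinkings `K ⊆ V ⊆ V̄ ⊆ W ⊆ W̄ ⊆ S` and `K' ⊆ W' ⊆ W̄' ⊆ U`
  obtain ⟨V, hVo, hKV, hVS⟩ := normal_exists_closure_subset hK.isClosed hS hKS
  obtain ⟨W, hWo, hVW, hWS⟩ := normal_exists_closure_subset isClosed_closure hS hVS
  obtain ⟨W', hW'o, hK'W', hW'U⟩ := normal_exists_closure_subset hK'.isClosed hU hK'U
  -- an Urysohn function: `ρ = 0` on `V̄`, `ρ = 1` off `W`
  obtain ⟨ρ, hρ₀, hρ₁, hρI⟩ := exists_continuous_zero_one_of_isClosed isClosed_closure hWo.isClosed_compl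
    (disjoint_compl_right_iff_subset.2 hVW)
  -- uniform consistency of `Φ` with `D` on the compact `C = W̄ ∩ W̄'`
  set C : Set A := closure W ∩ closure W' with hCdef
  have hC : IsCompact C := (isClosed_closure.inter isClosed_closure).isCompact
  obtain ⟨δ, hδ, hδε, hlevel⟩ := hΦ.exists_forall_level hS hε D hC
    (inter_subset_left.trans hWS) (inter_subset_right.trans hW'U)
  set e := D.box with hedef
  have he : e ∈ F.atlas := D.box_mem
  set Φ' : A → ℝ → M := glueFun Φ G e D.ψ ρ W' with hΦ'def
  have hIδ : Ioo (τ₀ - δ) (τ₀ + δ) ⊆ Ioo (τ₀ - ε) (τ₀ + ε) := Ioo_subset_Ioo (by linarith) (by linarith)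
  -- on `V ∩ W'` the glued fence is the old one
  have heqV : ∀ a ∈ V, ∀ τ ∈ Ioo (τ₀ - δ) (τ₀ + δ), Φ' a τ = Φ a τ := by
    intro a haV τ hτ
    by_cases haW' : a ∈ W'
    · rw [hΦ'def, glueFun_of_mem haW']
      have hρa : ρ a = 0 := hρ₀ (subset_closure haV)
      obtain ⟨hsrc, hht⟩ := hlevel a ⟨subset_closure (hVW (subset_closure haV)),
        subset_closure haW'⟩ τ hτ
      rw [hρa, sub_zero, one_smul, zero_smul, add_zero, ← hht]
      exact e.left_inv hsrc
    · rw [hΦ'def, glueFun_of_not_mem haW']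
  -- the glued fence is a point of the box at height `ψ τ` on `W'`
  have hW'lev : ∀ a ∈ W', ∀ τ, Φ' a τ ∈ e.source ∧ height e (Φ' a τ) = D.ψ τ := by
    intro a ha τ
    rw [hΦ'def, glueFun_of_mem ha]
    exact ⟨e.map_target (F.mk_mem_target he _ _),
      congrArg Prod.snd (e.right_inv (F.mk_mem_target he _ _))⟩
  refine ⟨V ∪ W', hVo.union hW'o, union_subset_union hKV hK'W', δ, hδ, hδε, Φ', ⟨?_, ?_, ?_⟩,
    V, hVo, hKV, heqV⟩
  · -- continuity on `(V ∪ W') × (τ₀ - δ, τ₀ + δ)`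
    refine ((hVo.union hW'o).prod isOpen_Ioo).continuousOn_iff.2 ?_
    rintro ⟨a, τ⟩ ⟨haS', hτ⟩
    have hg : Continuous fun a ↦ ofLeafSpace (G a).pt := F.continuous_ofLeafSpace_pt G
    by_cases haW' : a ∈ W'
    · -- near `(a, τ)` the glued fence is given by the interpolation formula
      have hev : (uncurry Φ') =ᶠ[𝓝 (a, τ)] fun x ↦
          e.symm ((1 - ρ x.1) • (e (Φ x.1 x.2)).1 + ρ x.1 • (e (ofLeafSpace (G x.1).pt)).1,
            D.ψ x.2) := by
        filter_upwards [(continuous_fst.tendsto (a, τ)).eventually (hW'o.mem_nhds haW')] with x hx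
        exact glueFun_of_mem hx x.2
      refine ContinuousAt.congr ?_ hev.symm
      refine (F.continuous_symm_of_mem he).continuousAt.comp (ContinuousAt.prodMk ?_ ?_)
      · refine ContinuousAt.add ?_ ?_
        · -- the term `(1 - ρ a) • (e (Φ a τ)).1`
          by_cases haW : a ∈ closure W
          · have hca : ContinuousAt (uncurry Φ) (a, τ) := hΦ.continuousAt hS (hWS haW) (hIδ hτ)
            have hsrc : Φ a τ ∈ e.source := (hlevel a ⟨haW, subset_closure haW'⟩ τ hτ).1
            refine ((continuous_const.sub (ρ.continuous.comp continuous_fst)).continuousAt).smul ?_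
            exact continuous_fst.continuousAt.comp ((e.continuousAt hsrc).comp_of_eq hca rfl)
          · -- off `W̄`, `ρ = 1` near `a` and the term vanishes identically
            have hev₁ : (fun x : A × ℝ ↦ (1 - ρ x.1) • (e (Φ x.1 x.2)).1) =ᶠ[𝓝 (a, τ)]
                fun _ ↦ (0 : B) := by
              have hn : (closure W)ᶜ ∈ 𝓝 a := isClosed_closure.isOpen_compl.mem_nhds haW
              filter_upwards [(continuous_fst.tendsto (a, τ)).eventually hn] with x hx
              have : ρ x.1 = 1 := hρ₁ (fun h ↦ hx (subset_closure h))
              rw [this, sub_self, zero_smul]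
            exact continuousAt_const.congr hev₁.symm
        · have hga : ofLeafSpace (G a).pt ∈ e.source := D.pt_mem_source (hW'U (subset_closure haW'))
          exact ((ρ.continuous.comp continuous_fst).continuousAt).smul
            (continuous_fst.continuousAt.comp ((e.continuousAt hga).comp_of_eq
              (hg.comp continuous_fst).continuousAt rfl))
      · exact (D.ψ_cont.continuousAt (isOpen_Ioo.mem_nhds (hIδ hτ))).comp continuous_snd.continuousAt
    · -- `a ∈ V`: near `(a, τ)` the glued fence is the old fence
      have haV : a ∈ V := haS'.resolve_right haW'
      have hev : (uncurry Φ') =ᶠ[𝓝 (a, τ)] uncurry Φ := by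
        filter_upwards [(hVo.prod isOpen_Ioo).mem_nhds ⟨haV, hτ⟩] with x hx
        exact heqV x.1 hx.1 x.2 hx.2
      exact (hΦ.continuousAt hS (hVS (subset_closure haV)) (hIδ hτ)).congr hev.symm
  · -- base points
    intro a haS'
    by_cases haW' : a ∈ W'
    · rw [hΦ'def, glueFun_of_mem haW']
      have hcoef : (1 - ρ a) • (e (Φ a τ₀)).1 = (1 - ρ a) • (e (ofLeafSpace (G a).pt)).1 := by
        by_cases haS : a ∈ S
        · rw [hΦ.base a haS]
        · have : ρ a = 1 := hρ₁ (fun h ↦ haS (hWS (subset_closure h)))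
          rw [this, sub_self, zero_smul, zero_smul]
      rw [hcoef, ← add_smul, sub_add_cancel, one_smul]
      have hpt := D.pt_mem a (hW'U (subset_closure haW'))
      rw [← hpt.2]
      exact e.left_inv hpt.1
    · have haV : a ∈ V := haS'.resolve_right haW'
      rw [hΦ'def, glueFun_of_not_mem haW']
      exact hΦ.base a (hVS (subset_closure haV))
  · -- local data
    intro a haS'
    by_cases haW' : a ∈ W'
    · refine ⟨W', hW'o.mem_nhds haW', D.restrict (fun x hx ↦ hW'U (subset_closure hx.1)) hδε,
        fun a' ha' τ _ ↦ ?_⟩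
      simp only [LocalDatum.restrict_box, LocalDatum.restrict_ψ]
      exact hW'lev a' ha'.1 τ
    · have haV : a ∈ V := haS'.resolve_right haW'
      have haS : a ∈ S := hVS (subset_closure haV)
      obtain ⟨U₁, hU₁, D₁, hD₁⟩ := hΦ.local_level a haS
      refine ⟨U₁ ∩ V, inter_mem hU₁ (hVo.mem_nhds haV),
        D₁.restrict (fun x hx ↦ ⟨hx.1.1, hVS (subset_closure hx.1.2)⟩) hδε, fun a' ha' τ hτ ↦ ?_⟩
      simp only [LocalDatum.restrict_box, LocalDatum.restrict_ψ]
      rw [heqV a' ha'.1.2 τ hτ]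
      exact hD₁ a' ⟨ha'.1.1, hVS (subset_closure ha'.1.2)⟩ τ (hIδ hτ)

end Glue

/-! ## Existence of fences over compact parameter spaces -/

section Existence

variable {F} [NormedSpace ℝ B]

/-- **Existence of fences, relative form.** Over a compact Hausdorff parameter space `A`, a
fence `Φ₀` over an open set `S₀` for a continuous family `G : A → F.GermSpace` of germs of
constant level `τ₀` can be modified away from a given compact `K₀ ⊆ S₀` into a fence over all of
`A`: choose local data around each point with compact neighbourhoods inside their domains,
extract a finite subcover, and glue one datum at a time (`IsFenceOn.glue`), which never changes
the fence near the compact set already covered. [folklore] -/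
theorem exists_isFenceOn_univ_of_isFenceOn [CompactSpace A] [T2Space A] (G : C(A, F.GermSpace))
    {τ₀ : ℝ} (hG : ∀ a, GermSpace.level (G a) = τ₀) {ε₀ : ℝ} (hε₀ : 0 < ε₀) {Φ₀ : A → ℝ → M}
    {S₀ : Set A} (h₀ : IsFenceOn F G τ₀ ε₀ Φ₀ S₀) (hS₀ : IsOpen S₀) {K₀ : Set A} (hK₀ : IsCompact K₀)
    (hK₀S₀ : K₀ ⊆ S₀) :
    ∃ ε > (0 : ℝ), ∃ Φ : A → ℝ → M, IsFenceOn F G τ₀ ε Φ univ ∧ ∃ V : Set A, IsOpen V ∧ K₀ ⊆ V ∧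
      ∀ a ∈ V, ∀ τ ∈ Ioo (τ₀ - ε) (τ₀ + ε), Φ a τ = Φ₀ a τ := by
  classical
  -- local data around each point
  choose εa hεa Ua hUo haU hD using fun a ↦ F.exists_localDatum G hG a
  -- open neighbourhoods with (compact) closures inside the domains of the data
  have hV : ∀ a, ∃ V : Set A, IsOpen V ∧ a ∈ V ∧ closure V ⊆ Ua a := fun a ↦ by
    obtain ⟨V, hVo, haV, hV⟩ := normal_exists_closure_subset isClosed_singleton (hUo a)
      (singleton_subset_iff.2 (haU a))
    exact ⟨V, hVo, haV rfl, hV⟩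
  choose Va hVo haV hVU using hV
  -- a finite subcover
  obtain ⟨T, hT⟩ := isCompact_univ.elim_finite_subcover Va hVo fun a _ ↦ mem_iUnion.2 ⟨a, haV a⟩
  -- a common level radius
  obtain ⟨ε, hε, hεε₀, hεle⟩ : ∃ ε > (0 : ℝ), ε ≤ ε₀ ∧ ∀ a ∈ T, ε ≤ εa a := by
    rcases T.eq_empty_or_nonempty with hTe | hTn
    · exact ⟨ε₀, hε₀, le_rfl, by simp [hTe]⟩
    · exact ⟨min ε₀ (T.inf' hTn εa), lt_min hε₀ ((Finset.lt_inf'_iff hTn).2 fun a _ ↦ hεa a),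
        min_le_left _ _, fun a ha ↦ (min_le_right _ _).trans (Finset.inf'_le εa ha)⟩
  -- glue one datum at a time, keeping `K₀` covered and the fence near `K₀` unchanged
  have main : ∀ s : Finset A, s ⊆ T → ∃ S : Set A, IsOpen S ∧ (K₀ ∪ ⋃ a ∈ s, closure (Va a)) ⊆ S ∧
      ∃ δ > (0 : ℝ), δ ≤ ε ∧ ∃ Φ : A → ℝ → M, IsFenceOn F G τ₀ δ Φ S ∧ ∃ V : Set A, IsOpen V ∧
        K₀ ⊆ V ∧ ∀ a ∈ V, ∀ τ ∈ Ioo (τ₀ - δ) (τ₀ + δ), Φ a τ = Φ₀ a τ := by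
    intro s
    induction s using Finset.induction_on with
    | empty =>
      intro
      refine ⟨S₀, hS₀, by simpa using hK₀S₀, ε, hε, le_rfl, Φ₀, h₀.mono Subset.rfl hεε₀, S₀, hS₀,
        hK₀S₀, fun _ _ _ _ ↦ rfl⟩
    | @insert a s _ ih =>
      intro hsub
      obtain ⟨S, hSo, hKS, δ, hδ, hδε, Φ, hΦ, V, hVo', hK₀V, hV⟩ :=
        ih ((Finset.subset_insert a s).trans hsub)
      have haT : a ∈ T := hsub (Finset.mem_insert_self a s)
      obtain ⟨D⟩ := hD a
      have hKc : IsCompact (K₀ ∪ ⋃ b ∈ s, closure (Va b)) :=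
        hK₀.union (s.isCompact_biUnion fun b _ ↦ isClosed_closure.isCompact)
      obtain ⟨S', hS'o, hKS', δ', hδ', hδ'δ, Φ', hΦ', V', hV'o, hKV', hV'⟩ := hΦ.glue G hSo hδ hKc hKS
        (D.restrict Subset.rfl (hδε.trans (hεle a haT))) (hUo a) isClosed_closure.isCompact (hVU a)
      refine ⟨S', hS'o, ?_, δ', hδ', hδ'δ.trans hδε, Φ', hΦ', V ∩ V', hVo'.inter hV'o,
        subset_inter hK₀V (subset_union_left.trans hKV'), fun b hb τ hτ ↦ ?_⟩
      · rw [Finset.set_biUnion_insert, ← union_assoc, union_right_comm]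
        exact hKS'
      · rw [hV' b hb.2 τ hτ]
        exact hV b hb.1 τ (Ioo_subset_Ioo (by linarith) (by linarith) hτ)
  obtain ⟨S, -, hKS, δ, hδ, -, Φ, hΦ, V, hVo', hK₀V, hV⟩ := main T Subset.rfl
  have hS : S = univ := univ_subset_iff.1
    (hT.trans (((iUnion₂_mono fun a _ ↦ subset_closure).trans subset_union_right).trans hKS))
  subst hS
  exact ⟨δ, hδ, Φ, hΦ, V, hVo', hK₀V, hV⟩

/-- **Existence of fences.** Over a compact Hausdorff parameter space `A`, every continuous
family `G : A → F.GermSpace` of germs of constant level `τ₀` admits a fence of some level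
radius `ε > 0` over all of `A` (the relative form with the empty initial fence). With `G` the
lift of a leaf map `g` from a simply connected `A` (`existsUnique_lift_of_simplyConnectedSpace`)
this is the product structure of the foliation near `g(A)` on which the Reeb stability theorem
and Novikov's arguments rest (Camacho–Lins Neto, Ch. IV §2, Thm. 2 and its proof, and §3,
Lemma 4; Hector–Hirsch A, Ch. III 2.1.8). [cite: CamachoLinsNeto1985, Ch. IV §2] -/
theorem exists_isFenceOn_univ [CompactSpace A] [T2Space A] (G : C(A, F.GermSpace)) {τ₀ : ℝ}
    (hG : ∀ a, GermSpace.level (G a) = τ₀) :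
    ∃ ε > (0 : ℝ), ∃ Φ : A → ℝ → M, IsFenceOn F G τ₀ ε Φ univ := by
  obtain ⟨ε, hε, Φ, hΦ, -⟩ := exists_isFenceOn_univ_of_isFenceOn G hG one_pos
    (IsFenceOn.empty G τ₀ 1 fun a _ ↦ ofLeafSpace (G a).pt) isOpen_empty isCompact_empty
    (empty_subset _)
  exact ⟨ε, hε, Φ, hΦ⟩

end Existence

/-! ## Properties of fences: leaf horizontals, transverse verticals, levels -/

namespace IsFenceOn

variable {F} {G : A → F.GermSpace} {τ₀ ε : ℝ} {Φ : A → ℝ → M} {S : Set A}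

/-- **The verticals of a fence are injective** on the level interval (their heights `ψ τ` in
a local box are). [folklore] -/
theorem injOn (h : IsFenceOn F G τ₀ ε Φ S) {a : A} (ha : a ∈ S) :
    InjOn (Φ a) (Ioo (τ₀ - ε) (τ₀ + ε)) := by
  obtain ⟨U, hU, D, hD⟩ := h.local_level a ha
  intro τ₁ h₁ τ₂ h₂ heq
  have e₁ := (hD a ⟨mem_of_mem_nhds hU, ha⟩ τ₁ h₁).2
  have e₂ := (hD a ⟨mem_of_mem_nhds hU, ha⟩ τ₂ h₂).2
  rw [heq] at e₁
  exact D.ψ_inj h₁ h₂ (e₁.symm.trans e₂)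

/-- **The verticals of a fence are continuous** on the level interval (over an open `S`).
[folklore] -/
theorem continuousOn_apply (h : IsFenceOn F G τ₀ ε Φ S) (hS : IsOpen S) {a : A} (ha : a ∈ S) :
    ContinuousOn (Φ a) (Ioo (τ₀ - ε) (τ₀ + ε)) := fun _ hτ ↦
  ((h.continuousAt hS ha hτ).comp_of_eq (continuousAt_const.prodMk continuousAt_id) rfl).continuousWithinAt

/-- **The first integral of `G a'` takes the value `τ` at `Φ a' τ`**: near each point of `S`
there is a local datum `(e, φ, ψ)` representing `G` with `φ (h_e (Φ a' τ)) = τ` — the point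
`Φ a' τ` lies on the local leaf of level `τ`. [folklore] -/
theorem exists_localDatum_apply_eq (h : IsFenceOn F G τ₀ ε Φ S) {a : A} (ha : a ∈ S) :
    ∃ U ∈ 𝓝 a, ∃ D : LocalDatum F G τ₀ ε (U ∩ S), ∀ a' ∈ U ∩ S, ∀ τ ∈ Ioo (τ₀ - ε) (τ₀ + ε),
      Φ a' τ ∈ D.box.source ∧ D.φ (height D.box (Φ a' τ)) = τ := by
  obtain ⟨U, hU, D, hD⟩ := h.local_level a ha
  refine ⟨U, hU, D, fun a' ha' τ hτ ↦ ⟨(hD a' ha' τ hτ).1, ?_⟩⟩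
  rw [(hD a' ha' τ hτ).2]
  exact D.φ_ψ τ hτ

/-- **The horizontals of a fence over the whole space are leaf maps**: for each `τ` in the
level interval, `a ↦ Φ a τ` is continuous into the leaf space `M^δ` (it is continuous into
`M` and its height in a local box is the constant `ψ τ` — the criterion
`continuous_toLeafSpace_comp_of_exists`). Hence for connected `A` each horizontal runs in a
single leaf (`mem_leaf_of_continuous_toLeafSpace`). [folklore] -/
theorem continuous_toLeafSpace (h : IsFenceOn F G τ₀ ε Φ univ) {τ : ℝ} (hτ : τ ∈ Ioo (τ₀ - ε) (τ₀ + ε)) :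
    Continuous (toLeafSpace ∘ fun a ↦ Φ a τ : A → F.LeafSpace) := by
  have hc : Continuous fun a ↦ Φ a τ := by
    have h₁ : ContinuousOn (uncurry Φ ∘ fun a : A ↦ (a, τ)) univ :=
      h.cont.comp (continuous_id.prodMk continuous_const).continuousOn fun a _ ↦ ⟨mem_univ a, hτ⟩
    exact continuousOn_univ.1 h₁
  refine F.continuous_toLeafSpace_comp_of_exists hc fun a ↦ ?_
  obtain ⟨U, hU, D, hD⟩ := h.local_level a (mem_univ a)
  refine ⟨D.box, D.box_mem, (hD a ⟨mem_of_mem_nhds hU, mem_univ a⟩ τ hτ).1, ?_⟩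
  filter_upwards [hU] with b hb
  rw [show (D.box (Φ b τ)).2 = height D.box (Φ b τ) from rfl,
    show (D.box (Φ a τ)).2 = height D.box (Φ a τ) from rfl,
    (hD b ⟨hb, mem_univ b⟩ τ hτ).2, (hD a ⟨mem_of_mem_nhds hU, mem_univ a⟩ τ hτ).2]

/-- For a connected parameter space, each horizontal of a fence over the whole space runs in
a single leaf. [folklore] -/
theorem mem_leaf [PreconnectedSpace A] (h : IsFenceOn F G τ₀ ε Φ univ) {τ : ℝ}
    (hτ : τ ∈ Ioo (τ₀ - ε) (τ₀ + ε)) (a b : A) : Φ b τ ∈ F.leaf (Φ a τ) :=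
  F.mem_leaf_of_continuous_toLeafSpace (h.continuous_toLeafSpace hτ) a b

end IsFenceOn

/-- **Fences over simply connected compact leaf maps** (the product structure of a `C⁰`
codimension-one foliation over a simply connected compact subset of a leaf: Camacho–Lins
Neto, Ch. IV §2, Thm. 2 (local stability), proof; Hector–Hirsch A, Ch. III 2.1.8): a leaf map
`g` from a simply connected, locally path connected, compact Hausdorff space `A` (a disc, a
sphere), a point `a₀` and a flow box `e ∋ g a₀` of the atlas determine a lift `G` of `g` to
the germ space with `G a₀` the germ of `h_e`, and a fence `Φ` over all of `A` at the level
`h_e (g a₀)`: `Φ a (h_e (g a₀)) = g a`, horizontals leaf maps, verticals injective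
transversals, `Φ a τ` on the local leaf on which the continued first integral takes the
value `τ`. [cite: CamachoLinsNeto1985, Ch. IV §2, Thm. 2] -/
theorem exists_isFenceOn_of_simplyConnectedSpace [NormedSpace ℝ B] [SimplyConnectedSpace A]
    [LocallyPathConnectedSpace A] [CompactSpace A] [T2Space A] (g : C(A, F.LeafSpace)) (a₀ : A)
    {e : OpenPartialHomeomorph M (B × ℝ)} (he : e ∈ F.atlas) (ha₀ : ofLeafSpace (g a₀) ∈ e.source) :
    ∃ G : C(A, F.GermSpace), GermSpace.proj ∘ G = g ∧ G a₀ = GermSpace.ofHeight F he (g a₀) ha₀ ∧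
      ∃ ε > (0 : ℝ), ∃ Φ : A → ℝ → M, IsFenceOn F G (e (ofLeafSpace (g a₀))).2 ε Φ univ := by
  obtain ⟨G, ⟨hG₀, hGg⟩, -⟩ := F.existsUnique_lift_of_simplyConnectedSpace g a₀ he ha₀
  have hlev : ∀ a, GermSpace.level (G a) = (e (ofLeafSpace (g a₀))).2 := fun a ↦ by
    rw [F.level_apply_eq_of_preconnectedSpace G a a₀, hG₀, GermSpace.level_ofHeight]
  obtain ⟨ε, hε, Φ, hΦ⟩ := exists_isFenceOn_univ G hlev
  exact ⟨G, hGg, hG₀, ε, hε, Φ, hΦ⟩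

end Foliation

end Literature.Topology.FourManifolds
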